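import Mathlib
import HarnessLib
import Summits.HubbardSuperconductivity.HubbardSuperconductivity.Theorems.KLProgrammeSWaveCascadeAllScales

/-!
# Route `KLProgramme` — row 0′ (child 1), CARRIER-GENERIC, at one total-momentum class (ladder inside the class, frozen increments after the exit),
# with the Riccati COMPARISON SEQUENCE EXPORTED AT ALL SCALES

Cell gate-hubbard-kl, seat hubbard-kl-k3c1-p1 (g19; child-1 lineage; technique «composed-map remainder propagation»).  Sequel to `…SWaveCascadeAllScales`
(pen g25 (R372)(B) «CHILD1-ALLSCALES-EXPORT»): the all-scales twin of `amplitudeArray_envelope_edge` (`…SWaveCascadeArrayEdge`, whose proof is adapted here).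
**`amplitudeArray_envelope_edge_allScales`**: the hypotheses of `amplitudeArray_envelope_edge` VERBATIM plus `g ≥ 0` (the frozen-gain majorant; in the model
`gainBar ≥ 0`) ⟹ ONE comparison sequence `Us` for the whole history: `Us 0 = U`, the exact law `Us (i+1) = Us i/(1 + W i·Us i)` with `|W i| ≤ m i ≤ b`, the sign
defect `m i − W i ≤ δ (i+1)` at every in-class step `i < n`, `W i = m i = 0` (so `Us (i+1) = Us i`) at every step past the class exit or past `n`, the negative-mass
line `16·U·Σ_{i<n}(m i − W i) ≤ 1`, and at EVERY scale `j ≤ n`: `0 ≤ Us j ≤ (16/15)·U` and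
`‖𝒜 j k k' − Us j‖ ≤ 12·((ι₀ + Στ + Xtot) + (Στ + Xsup)) + (Gtot + Xtot + Σ_{i<n} ε i)` on `B × B` — the SAME numbers as `amplitudeArray_envelope_edge` at scale `n`.
With `…SWaveCascadeAllScales` §1 (`sWaveFloor_le_add_sum`, `sWaveFloor_totalVariation_le'`, instantiated at `ν i := m i − W i`) the sequence is quasi-monotone,
`Us j ≤ Us i + (16U/15)²·Σ_{l∈[i,j)}(m l − W l)`, of total variation `≤ (257/225)·U`.  The model instance is `…KLRegimeSplitFlowPairArrayEdgeAllScales`.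
Everything is proved; no definitions; nothing about the model is asserted; nothing asserts superconductivity.
-/

noncomputable section

namespace Summit.HubbardSuperconductivity.HubbardSuperconductivity.Theorems.SWaveCascade

set_option linter.dupNamespace false -- summit = problem name (single-conjunct summit), D-0017

open Finset

variable {S : Type*} [Fintype S] [DecidableEq S]

/-- **Row 0′ at one total-momentum class, for an arbitrary amplitude family — ALL-SCALES EXPORT.**  Hypotheses = those of `amplitudeArray_envelope_edge`
verbatim plus `g ≥ 0` (the frozen-gain majorant; in the model `gainBar ≥ 0`).  Conclusion: ONE comparison sequence `Us` for the whole history — `Us 0 = U`,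
the exact law `Us (i+1) = Us i/(1 + W i·Us i)` with `|W i| ≤ m i ≤ b`, the sign defect `m i − W i ≤ δ (i+1)` at every in-class step `i < n`, `W i = m i = 0`
(so `Us (i+1) = Us i`) at every step past the class exit or past `n`, the negative-mass line `16·U·Σ_{i<n}(m i − W i) ≤ 1` — and at EVERY scale `j ≤ n`:
`0 ≤ Us j ≤ (16/15)·U` and `‖𝒜 j k k' − Us j‖ ≤ 12·((ι₀ + Στ + Xtot) + (Στ + Xsup)) + (Gtot + Xtot + Σ_{i<n} ε i)` on `B × B`. -/
theorem amplitudeArray_envelope_edge_allScales (B : Finset S) (𝒜 : ℕ → S → S → ℂ) (InClass : ℕ → Prop) [DecidablePred InClass]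
    (hmono : ∀ {j m : ℕ}, InClass m → j ≤ m → InClass j)
    {U b ι₀ Gtot : ℝ} (hU : 0 ≤ U) (hb : 0 ≤ b) (hι₀ : 0 ≤ ι₀) (hGtot0 : 0 ≤ Gtot) (τ ε : ℕ → ℝ) (hτ0 : ∀ j, 0 ≤ τ j)
    (hε0 : ∀ j, 0 ≤ ε j) {n : ℕ} (g X : ℕ → S → S → ℝ) {Xtot Xsup : ℝ} (hg0 : ∀ j k k', 0 ≤ g j k k')
    (hX0 : ∀ j k k', 0 ≤ X j k k') (hXtot0 : 0 ≤ Xtot) (hXsup0 : 0 ≤ Xsup) (hXsup : ∀ j k k', X j k k' ≤ Xsup)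
    (hXsum : ∀ (t : ℕ) (k k' : S), ∑ j ∈ Ioc t n, X j k k' ≤ Xtot)
    (hXtot : ∀ k k' : S, X 0 k k' + ∑ i ∈ range n, X (i + 1) k k' ≤ Xtot)
    (δ : ℕ → ℝ) (hneg : ∀ t ≤ n, InClass t → 16 * U * ∑ i ∈ range t, δ (i + 1) ≤ 1)
    (h0 : ∀ k ∈ B, ∀ k' ∈ B, ‖𝒜 0 k k' - (U : ℂ)‖ ≤ ι₀ + X 0 k k')
    (hsteps : ∀ j, 1 ≤ j → j ≤ n → InClass j →
      ∃ w : S → ℝ, (∑ p, |w p| ≤ b) ∧ (∑ p, (|w p| - w p) ≤ δ j) ∧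
        ∃ N : Matrix S S ℂ,
          (1 + Matrix.diagonal (fun p => (w p : ℂ)) * Matrix.of (fun s t => if s ∈ B ∧ t ∈ B then 𝒜 (j - 1) s t else 0)) * N = 1 ∧
          ∀ k ∈ B, ∀ k' ∈ B,
            ‖𝒜 j k k' - (Matrix.of (fun s t => if s ∈ B ∧ t ∈ B then 𝒜 (j - 1) s t else 0) * N) k k'‖ ≤ τ (j - 1) + X j k k')
    (hincr : ∀ j, 1 ≤ j → j ≤ n → ∀ k ∈ B, ∀ k' ∈ B, ‖𝒜 j k k' - 𝒜 (j - 1) k k'‖ ≤ g j k k' + ε (j - 1) + X j k k')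
    (hg : ∀ t ≤ n, ¬ InClass (t + 1) → ∀ k ∈ B, ∀ k' ∈ B, ∑ j ∈ Ioc t n, g j k k' ≤ Gtot)
    (hsmall : 8 * 42 * ((ι₀ + ∑ j ∈ range n, τ j + Xtot) + (∑ j ∈ range n, τ j + Xsup)) * (b * n) ≤ 1) :
    ∃ Us W m : ℕ → ℝ, Us 0 = U ∧ (∀ i, Us (i + 1) = Us i / (1 + W i * Us i)) ∧
      (∀ i, |W i| ≤ m i ∧ m i ≤ b) ∧
      (∀ i < n, InClass (i + 1) → m i - W i ≤ δ (i + 1)) ∧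
      (∀ i, (n ≤ i ∨ ¬ InClass (i + 1)) → W i = 0 ∧ m i = 0) ∧
      16 * U * ∑ i ∈ range n, (m i - W i) ≤ 1 ∧
      ∀ j ≤ n, 0 ≤ Us j ∧ Us j ≤ 16 / 15 * U ∧ ∀ k ∈ B, ∀ k' ∈ B,
        ‖𝒜 j k k' - (Us j : ℂ)‖ ≤
          12 * ((ι₀ + ∑ j ∈ range n, τ j + Xtot) + (∑ j ∈ range n, τ j + Xsup)) + (Gtot + Xtot + ∑ i ∈ range n, ε i) := by
  classical
  have hSe0 : 0 ≤ ∑ i ∈ range n, ε i := sum_nonneg fun i _ => hε0 i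
  have hSτ0 : 0 ≤ ∑ j ∈ range n, τ j := sum_nonneg fun j _ => hτ0 j
  -- the frozen part between two scales `t ≤ j ≤ n` once the class is left at `t + 1`
  have hfrozen : ∀ t j, t ≤ j → j ≤ n → ¬ InClass (t + 1) → ∀ k ∈ B, ∀ k' ∈ B,
      ‖𝒜 j k k' - 𝒜 t k k'‖ ≤ Gtot + Xtot + ∑ i ∈ range n, ε i := by
    intro t j htj hjn hexit k hk k' hk'
    have h := amplitudeFrozen_increment 𝒜 htj g X ε hε0 (fun i hi hij => hincr i (by omega) (hij.trans hjn) k hk k' hk')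
      ((sum_le_sum_of_subset_of_nonneg (Ioc_subset_Ioc_right hjn) fun i _ _ => hg0 i k k').trans
        (hg t (htj.trans hjn) hexit k hk k' hk'))
      ((sum_le_sum_of_subset_of_nonneg (Ioc_subset_Ioc_right hjn) fun i _ _ => hX0 i k k').trans (hXsum t k k'))
    exact h.trans (add_le_add le_rfl (sum_le_sum_of_subset_of_nonneg (range_mono hjn) fun i _ _ => hε0 i))
  by_cases hQ0 : InClass 0
  · -- the last in-class scale `t`
    set t : ℕ := Nat.findGreatest (fun s => InClass s) n with ht_def
    have htn : t ≤ n := Nat.findGreatest_le n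
    have hQt : InClass t := Nat.findGreatest_spec (P := fun s => InClass s) (Nat.zero_le n) hQ0
    have hle_t : ∀ i, i ≤ n → InClass i → i ≤ t := fun i hin hQi => Nat.le_findGreatest hin hQi
    have hexit_ge : ∀ i, ¬ InClass (i + 1) → t ≤ i := fun i hQi => by
      by_contra h
      exact hQi (hmono hQt (by omega))
    have hSt : ∑ j ∈ range t, τ j ≤ ∑ j ∈ range n, τ j :=
      sum_le_sum_of_subset_of_nonneg (range_mono htn) fun j _ _ => hτ0 j
    have hSt0 : 0 ≤ ∑ j ∈ range t, τ j := sum_nonneg fun j _ => hτ0 j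
    -- the ladder data up to `t`
    have hsteps' : ∀ i < t, ∃ w : S → ℝ, (∑ p, |w p| ≤ b) ∧ (∑ p, (|w p| - w p) ≤ δ (i + 1)) ∧
        ∃ N : Matrix S S ℂ,
          (1 + Matrix.diagonal (fun p => (w p : ℂ)) * Matrix.of (fun s t => if s ∈ B ∧ t ∈ B then 𝒜 i s t else 0)) * N = 1 ∧
          ∀ k ∈ B, ∀ k' ∈ B,
            ‖𝒜 (i + 1) k k' - (Matrix.of (fun s t => if s ∈ B ∧ t ∈ B then 𝒜 i s t else 0) * N) k k'‖ ≤ τ i + X (i + 1) k k' := by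
      intro i hi
      have h := hsteps (i + 1) (Nat.le_add_left 1 i) ((Nat.succ_le_of_lt hi).trans htn) (hmono hQt (Nat.succ_le_of_lt hi))
      simp only [Nat.add_sub_cancel] at h
      exact h
    have hXtot' : ∀ k k' : S, X 0 k k' + ∑ i ∈ range t, X (i + 1) k k' ≤ Xtot := fun k k' =>
      (add_le_add le_rfl (sum_le_sum_of_subset_of_nonneg (range_mono htn) fun i _ _ => hX0 _ _ _)).trans (hXtot k k')
    have hsmall' : 8 * 42 * ((ι₀ + ∑ j ∈ range t, τ j + Xtot) + (∑ j ∈ range t, τ j + Xsup)) * (b * t) ≤ 1 := by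
      refine le_trans ?_ hsmall
      have ht' : (t : ℝ) ≤ n := by exact_mod_cast htn
      have h1 : (ι₀ + ∑ j ∈ range t, τ j + Xtot) + (∑ j ∈ range t, τ j + Xsup) ≤
          (ι₀ + ∑ j ∈ range n, τ j + Xtot) + (∑ j ∈ range n, τ j + Xsup) := by linarith
      have hX0' : 0 ≤ (ι₀ + ∑ j ∈ range n, τ j + Xtot) + (∑ j ∈ range n, τ j + Xsup) := by linarith
      exact mul_le_mul (mul_le_mul_of_nonneg_left h1 (by norm_num)) (mul_le_mul_of_nonneg_left ht' hb)
        (mul_nonneg hb (Nat.cast_nonneg t)) (mul_nonneg (by norm_num) hX0')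
    obtain ⟨Us, W, m, hUs0, hlaw, hWm, hmb, hzero, hnegm, hdev⟩ :=
      amplitudeLadder_envelope_edge_allScales B 𝒜 (n := t) hU hι₀ τ hτ0 X hX0
        (fun i _ k k' => hXsup (i + 1) k k') hXtot' hXtot0 hXsup0 (fun i => δ (i + 1)) (hneg t htn hQt) h0 hsteps' hsmall'
    -- the comparison value is frozen from `t` on
    have hfrozenU : ∀ i, t ≤ i → Us i = Us t := by
      intro i hti
      induction i, hti using Nat.le_induction with
      | base => rfl
      | succ i hti ih => rw [hlaw i, (hzero i hti).1, zero_mul, add_zero, div_one, ih]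
    refine ⟨Us, W, m, hUs0, hlaw, fun i => ⟨hWm i, ?_⟩, fun i hi hQi => ?_, fun i hi => ?_, ?_, fun j hjn => ?_⟩
    · -- `m i ≤ b`
      rcases Nat.lt_or_ge i t with h | h
      · exact (hmb i h).1
      · rw [(hzero i h).2]; exact hb
    · -- the sign defect at an in-class step
      exact (hmb i (Nat.lt_of_succ_le (hle_t (i + 1) (Nat.succ_le_of_lt hi) hQi))).2
    · -- past `n` or past the exit
      rcases hi with h | h
      · exact hzero i (htn.trans h)
      · exact hzero i (hexit_ge i h)
    · -- the negative-mass line: the defects vanish from `t` on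
      rwa [← sum_subset (range_mono htn) fun i _ hit => by
        have hti : t ≤ i := by simp only [mem_range, not_lt] at hit; exact hit
        rw [(hzero i hti).1, (hzero i hti).2, sub_zero]]
    · -- the envelope at scale `j ≤ n`
      rcases le_or_gt j t with hjt | htj
      · obtain ⟨hUj0, hUjU, hd⟩ := hdev j hjt
        refine ⟨hUj0, hUjU, fun k hk k' hk' => (hd k hk k' hk').trans ?_⟩
        nlinarith [hSt, hι₀, hSt0, hXtot0, hXsup0, hGtot0, hSe0]
      · obtain ⟨hUt0, hUtU, hd⟩ := hdev t le_rfl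
        rw [hfrozenU j htj.le]
        refine ⟨hUt0, hUtU, fun k hk k' hk' => ?_⟩
        have hnot : ¬ InClass (t + 1) :=
          Nat.findGreatest_is_greatest (P := fun s => InClass s) (Nat.lt_succ_self t) (by omega)
        have hfro := hfrozen t j htj.le hjn hnot k hk k' hk'
        have hlad := hd k hk k' hk'
        calc ‖𝒜 j k k' - (Us t : ℂ)‖ ≤ ‖𝒜 t k k' - (Us t : ℂ)‖ + ‖𝒜 j k k' - 𝒜 t k k'‖ := by
              rw [show 𝒜 j k k' - (Us t : ℂ) = (𝒜 t k k' - (Us t : ℂ)) + (𝒜 j k k' - 𝒜 t k k') by ring]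
              exact norm_add_le _ _
          _ ≤ _ := by
              refine (add_le_add hlad hfro).trans ?_
              nlinarith [hSt, hι₀, hSt0, hXtot0, hXsup0]
  · -- never in the class: frozen from scale 0 around the bare value `U`
    have hexit : ¬ InClass (0 + 1) := fun h => hQ0 (hmono h (Nat.zero_le 1))
    refine ⟨fun _ => U, fun _ => 0, fun _ => 0, rfl, fun i => by simp, fun i => ⟨by simp, hb⟩, fun i _ hQi => ?_,
      fun i _ => ⟨rfl, rfl⟩, by simp, fun j hjn => ⟨hU, by linarith, fun k hk k' hk' => ?_⟩⟩
    · exact absurd (hmono hQi (Nat.zero_le _)) hQ0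
    have hfro := hfrozen 0 j (Nat.zero_le j) hjn hexit k hk k' hk'
    have h0' := h0 k hk k' hk'
    have hX0le : X 0 k k' ≤ Xtot :=
      (le_add_of_nonneg_right (sum_nonneg fun i _ => hX0 (i + 1) k k')).trans (hXtot k k')
    calc ‖𝒜 j k k' - (U : ℂ)‖ ≤ ‖𝒜 j k k' - 𝒜 0 k k'‖ + ‖𝒜 0 k k' - (U : ℂ)‖ := by
          rw [show 𝒜 j k k' - (U : ℂ) = (𝒜 j k k' - 𝒜 0 k k') + (𝒜 0 k k' - (U : ℂ)) by ring]
          exact norm_add_le _ _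
      _ ≤ _ := by
          refine (add_le_add hfro h0').trans ?_
          nlinarith [hSτ0, hι₀, hXtot0, hXsup0, hX0le]

end Summit.HubbardSuperconductivity.HubbardSuperconductivity.Theorems.SWaveCascade

end
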